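import Summits.KontsevichZagierPeriods.KontsevichZagierPeriods.Theorems.SoloBlindCellClass
import Literature.NumberTheory.Transcendental.SemialgebraicLineDeriv
import HarnessLib

/-!
# The Kontsevich–Zagier conjecture in dimension `≤ 1`, V: the primitive terms are cell sums

The three kinds of terms of the partial-fraction ("Baker") normal form of a rational integrand,
integrated over a compact interval `[u, v]` with algebraic end-points, are cell sums:
* `e/(1 − p x)` with `1 − p x > 0` on `[u, v]`, `p ≠ 0`: substitute `y = 1 − p x` — a logarithmic
  segment (`isCellSum_lineRep_inv_linear`);
* `e/((x − x₀)² + B²)`, `B > 0`: substitute `t = (x − x₀)/B` — an arctangent segment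
  (`isCellSum_lineRep_inv_quad`);
* `γ (x − x₀)/((x − x₀)² + B²)`, `B > 0`: split at `x₀` and substitute `y = (x − x₀)² + B²` on each
  side — two logarithmic segments (`isCellSum_lineRep_lin_quad`).
All substitutions are instances of the semialgebraic change of variables `lineRep_subst`.
-/

noncomputable section

open MeasureTheory Set Filter Finset
open scoped BigOperators Topology

namespace Summit.KontsevichZagierPeriods.KontsevichZagierPeriods.Theorems

open Literature.NumberTheory.Transcendental
open Literature.NumberTheory.Transcendental.KZ
open Literature.ModelTheory.ExponentialFields (IsSemialgebraic)

namespace SoloBlind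

/-! ## Images of intervals -/

/-- A continuous monotone map sends `[u, v]` onto `[φ u, φ v]`. -/
theorem image_Icc_of_monotoneOn {φ : ℝ → ℝ} {u v : ℝ} (huv : u ≤ v)
    (hc : ContinuousOn φ (Icc u v)) (hm : MonotoneOn φ (Icc u v)) :
    φ '' Icc u v = Icc (φ u) (φ v) :=
  Subset.antisymm hm.image_Icc_subset (intermediate_value_Icc huv hc)

/-- A continuous antitone map sends `[u, v]` onto `[φ v, φ u]`. -/
theorem image_Icc_of_antitoneOn {φ : ℝ → ℝ} {u v : ℝ} (huv : u ≤ v)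
    (hc : ContinuousOn φ (Icc u v)) (hm : AntitoneOn φ (Icc u v)) :
    φ '' Icc u v = Icc (φ v) (φ u) :=
  Subset.antisymm hm.image_Icc_subset (intermediate_value_Icc' huv hc)

/-! ## Substitution into a segment -/

section subst

variable {u v : ℝ} {f : ℝ → ℝ} {hS : IsSemialgebraic ℚ (line (Icc u v))}
  {hf : IsSemialgebraicFunOn ℚ (line (Icc u v)) (fun x => f (x 0))} {hi : IntegrableOn f (Icc u v)}

/-- A line representation which a semialgebraic injective `C¹` substitution turns into a
logarithmic segment `L(e; y₁, y₂)`, `0 < y₁`, is a cell sum. -/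
theorem isCellSum_lineRep_subst_log {y₁ y₂ e : ℝ} (he : IsAlgebraic ℚ e) (hy₁ : IsAlgebraic ℚ y₁)
    (hy₂ : IsAlgebraic ℚ y₂) (hy0 : 0 < y₁) (φ φ' : ℝ → ℝ)
    (hφ : IsSemialgebraicFunOn ℚ (line (Icc u v)) (fun x => φ (x 0)))
    (hder : ∀ t ∈ Icc u v, HasDerivWithinAt φ (φ' t) (Icc u v) t) (hinj : InjOn φ (Icc u v))
    (hT : φ '' Icc u v = Icc y₁ y₂) (hfg : ∀ t ∈ Icc u v, f t = e / φ t * |φ' t|) :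
    IsCellSum (of (lineRep (Icc u v) f hS hf hi)) :=
  (isCellSum_logSeg e y₁ y₂ he hy₁ hy₂ hy0).of_sub_mem
    (lineRep_subst (g := fun t => e / t) (T := Icc y₁ y₂) φ φ' hφ hder hinj hT.symm hfg)

/-- A line representation which a semialgebraic injective `C¹` substitution turns into an
arctangent segment `A(e; y₁, y₂)` is a cell sum. -/
theorem isCellSum_lineRep_subst_atan {y₁ y₂ e : ℝ} (he : IsAlgebraic ℚ e) (hy₁ : IsAlgebraic ℚ y₁)
    (hy₂ : IsAlgebraic ℚ y₂) (φ φ' : ℝ → ℝ)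
    (hφ : IsSemialgebraicFunOn ℚ (line (Icc u v)) (fun x => φ (x 0)))
    (hder : ∀ t ∈ Icc u v, HasDerivWithinAt φ (φ' t) (Icc u v) t) (hinj : InjOn φ (Icc u v))
    (hT : φ '' Icc u v = Icc y₁ y₂) (hfg : ∀ t ∈ Icc u v, f t = e / (1 + φ t ^ 2) * |φ' t|) :
    IsCellSum (of (lineRep (Icc u v) f hS hf hi)) :=
  (isCellSum_atanSeg e y₁ y₂ he hy₁ hy₂).of_sub_mem
    (lineRep_subst (g := fun t => e / (1 + t ^ 2)) (T := Icc y₁ y₂) φ φ' hφ hder hinj hT.symm hfg)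

end subst

/-! ## The three primitive terms -/

section terms

variable {u v : ℝ}

/-- **`∫ e/(1 − p x)` is a cell sum** (`1 − p x > 0` on `[u, v]`, `p ≠ 0`): the substitution
`y = 1 − p x` gives the logarithmic segment `L(± e/p; ·, ·)`. -/
theorem isCellSum_lineRep_inv_linear (hu : IsAlgebraic ℚ u) (hv : IsAlgebraic ℚ v) (huv : u ≤ v)
    {e p : ℝ} (he : IsAlgebraic ℚ e) (hp : IsAlgebraic ℚ p)
    (hp0 : p ≠ 0) (hpos : ∀ x ∈ Icc u v, 0 < 1 - p * x)
    {hS : IsSemialgebraic ℚ (line (Icc u v))}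
    {hf : IsSemialgebraicFunOn ℚ (line (Icc u v)) (fun x => e / (1 - p * x 0))}
    {hi : IntegrableOn (fun x => e / (1 - p * x)) (Icc u v)} :
    IsCellSum (of (lineRep (Icc u v) (fun x => e / (1 - p * x)) hS hf hi)) := by
  have hφ : IsSemialgebraicFunOn ℚ (line (Icc u v)) (fun x => 1 - p * x 0) :=
    (isSemialgebraicFunOn_const_of_isAlgebraic hS isAlgebraic_one).fun_sub
      ((isSemialgebraicFunOn_const_of_isAlgebraic hS hp).fun_mul (isSemialgebraicFunOn_apply hS 0))
  have hder : ∀ t ∈ Icc u v, HasDerivWithinAt (fun x => 1 - p * x) (-p) (Icc u v) t := by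
    intro t _
    have h : HasDerivAt (fun x => 1 - p * x) (-p) t := by
      simpa using ((hasDerivAt_id t).const_mul p).const_sub 1
    exact h.hasDerivWithinAt
  have hinj : InjOn (fun x => 1 - p * x) (Icc u v) := by
    intro a _ b _ h
    have : p * a = p * b := by simp only at h; linarith
    exact mul_left_cancel₀ hp0 this
  have hcont : ContinuousOn (fun x => 1 - p * x) (Icc u v) :=
    (continuous_const.sub (continuous_const.mul continuous_id)).continuousOn
  have hyu : IsAlgebraic ℚ (1 - p * u) := isAlgebraic_one.sub (hp.mul hu)
  have hyv : IsAlgebraic ℚ (1 - p * v) := isAlgebraic_one.sub (hp.mul hv)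
  rcases lt_or_gt_of_ne hp0 with hneg | hposp
  · -- `p < 0`: increasing substitution, Jacobian `|−p| = −p`
    have hmono : MonotoneOn (fun x => 1 - p * x) (Icc u v) := fun a _ b _ hab => by nlinarith
    have hT := image_Icc_of_monotoneOn huv hcont hmono
    refine isCellSum_lineRep_subst_log (he.mul hp.neg.inv |> fun h => by
      simpa [div_eq_mul_inv] using h) hyu hyv (hpos u (left_mem_Icc.mpr huv))
      (fun x => 1 - p * x) (fun _ => -p) hφ hder hinj hT fun t ht => ?_
    have h1 : (1 - p * t) ≠ 0 := (hpos t ht).ne'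
    rw [abs_of_pos (by linarith)]
    field_simp
  · -- `p > 0`: decreasing substitution, Jacobian `|−p| = p`
    have hanti : AntitoneOn (fun x => 1 - p * x) (Icc u v) := fun a _ b _ hab => by nlinarith
    have hT := image_Icc_of_antitoneOn huv hcont hanti
    refine isCellSum_lineRep_subst_log (he.mul hp.inv |> fun h => by
      simpa [div_eq_mul_inv] using h) hyv hyu (hpos v (right_mem_Icc.mpr huv))
      (fun x => 1 - p * x) (fun _ => -p) hφ hder hinj hT fun t ht => ?_
    have h1 : (1 - p * t) ≠ 0 := (hpos t ht).ne'
    rw [abs_of_neg (by linarith)]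
    field_simp

/-- **`∫ e/((x − x₀)² + B²)` is a cell sum** (`B > 0`): the substitution `t = (x − x₀)/B` gives
the arctangent segment `A(e/B; (u − x₀)/B, (v − x₀)/B)`. -/
theorem isCellSum_lineRep_inv_quad (hu : IsAlgebraic ℚ u) (hv : IsAlgebraic ℚ v) (huv : u ≤ v)
    {e x₀ B : ℝ} (he : IsAlgebraic ℚ e) (hx₀ : IsAlgebraic ℚ x₀)
    (hB : IsAlgebraic ℚ B) (hB0 : 0 < B)
    {hS : IsSemialgebraic ℚ (line (Icc u v))}
    {hf : IsSemialgebraicFunOn ℚ (line (Icc u v)) (fun x => e / ((x 0 - x₀) ^ 2 + B ^ 2))}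
    {hi : IntegrableOn (fun x => e / ((x - x₀) ^ 2 + B ^ 2)) (Icc u v)} :
    IsCellSum (of (lineRep (Icc u v) (fun x => e / ((x - x₀) ^ 2 + B ^ 2)) hS hf hi)) := by
  have hφ : IsSemialgebraicFunOn ℚ (line (Icc u v)) (fun x => (x 0 - x₀) / B) :=
    ((isSemialgebraicFunOn_apply hS 0).fun_sub (isSemialgebraicFunOn_const_of_isAlgebraic hS hx₀)).div
      (isSemialgebraicFunOn_const_of_isAlgebraic hS hB) fun _ _ => hB0.ne'
  have hder : ∀ t ∈ Icc u v, HasDerivWithinAt (fun x => (x - x₀) / B) (1 / B) (Icc u v) t :=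
    fun t _ => (((hasDerivAt_id t).sub_const x₀).div_const B).hasDerivWithinAt
  have hinj : InjOn (fun x => (x - x₀) / B) (Icc u v) := by
    intro a _ b _ h
    have : (a - x₀) / B = (b - x₀) / B := h
    rw [div_left_inj' hB0.ne'] at this
    linarith
  have hcont : ContinuousOn (fun x => (x - x₀) / B) (Icc u v) :=
    ((continuous_id.sub continuous_const).div_const B).continuousOn
  have hmono : MonotoneOn (fun x => (x - x₀) / B) (Icc u v) :=
    fun a _ b _ hab => div_le_div_of_nonneg_right (by linarith) hB0.le
  have hT := image_Icc_of_monotoneOn huv hcont hmono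
  refine isCellSum_lineRep_subst_atan (he.mul hB.inv |> fun h => by
    simpa [div_eq_mul_inv] using h) ((hu.sub hx₀).mul hB.inv |> fun h => by
    simpa [div_eq_mul_inv] using h) ((hv.sub hx₀).mul hB.inv |> fun h => by
    simpa [div_eq_mul_inv] using h)
    (fun x => (x - x₀) / B) (fun _ => 1 / B) hφ hder hinj hT fun t _ => ?_
  have h1 : (t - x₀) ^ 2 + B ^ 2 ≠ 0 := by positivity
  rw [abs_of_pos (by positivity)]
  field_simp
  ring

/-- `∫ γ (x − x₀)/((x − x₀)² + B²)` over `[u, v]` with `x₀ ≤ u` is a cell sum: the increasing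
substitution `y = (x − x₀)² + B²` gives `L(γ/2; ·, ·)`. -/
theorem isCellSum_lineRep_lin_quad_right (hu : IsAlgebraic ℚ u) (hv : IsAlgebraic ℚ v) (huv : u ≤ v)
    {γ x₀ B : ℝ} (hγ : IsAlgebraic ℚ γ)
    (hx₀ : IsAlgebraic ℚ x₀) (hB : IsAlgebraic ℚ B) (hB0 : 0 < B) (hx₀u : x₀ ≤ u)
    {hS : IsSemialgebraic ℚ (line (Icc u v))}
    {hf : IsSemialgebraicFunOn ℚ (line (Icc u v))
      (fun x => γ * (x 0 - x₀) / ((x 0 - x₀) ^ 2 + B ^ 2))}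
    {hi : IntegrableOn (fun x => γ * (x - x₀) / ((x - x₀) ^ 2 + B ^ 2)) (Icc u v)} :
    IsCellSum (of (lineRep (Icc u v) (fun x => γ * (x - x₀) / ((x - x₀) ^ 2 + B ^ 2))
      hS hf hi)) := by
  have hφ : IsSemialgebraicFunOn ℚ (line (Icc u v)) (fun x => (x 0 - x₀) ^ 2 + B ^ 2) :=
    (((isSemialgebraicFunOn_apply hS 0).fun_sub
      (isSemialgebraicFunOn_const_of_isAlgebraic hS hx₀)).fun_pow 2).fun_add
      (isSemialgebraicFunOn_const_of_isAlgebraic hS (by simpa [sq] using hB.mul hB))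
  have hder : ∀ t ∈ Icc u v,
      HasDerivWithinAt (fun x => (x - x₀) ^ 2 + B ^ 2) (2 * (t - x₀)) (Icc u v) t := by
    intro t _
    have h := (((hasDerivAt_id t).sub_const x₀).pow 2).add_const (B ^ 2)
    refine (h.congr_deriv ?_).hasDerivWithinAt
    simp
  have hsmono : StrictMonoOn (fun x => (x - x₀) ^ 2 + B ^ 2) (Icc u v) :=
    fun a ha b _ hab => by
      have : 0 ≤ a - x₀ := by linarith [ha.1]
      nlinarith
  have hcont : ContinuousOn (fun x => (x - x₀) ^ 2 + B ^ 2) (Icc u v) :=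
    (((continuous_id.sub continuous_const).pow 2).add continuous_const).continuousOn
  have hT := image_Icc_of_monotoneOn huv hcont hsmono.monotoneOn
  have hyu : IsAlgebraic ℚ ((u - x₀) ^ 2 + B ^ 2) :=
    (by simpa [sq] using (hu.sub hx₀).mul (hu.sub hx₀) : IsAlgebraic ℚ ((u - x₀) ^ 2)).add
      (by simpa [sq] using hB.mul hB)
  have hyv : IsAlgebraic ℚ ((v - x₀) ^ 2 + B ^ 2) :=
    (by simpa [sq] using (hv.sub hx₀).mul (hv.sub hx₀) : IsAlgebraic ℚ ((v - x₀) ^ 2)).add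
      (by simpa [sq] using hB.mul hB)
  refine isCellSum_lineRep_subst_log (e := γ / 2) (hγ.mul (isAlgebraic_nat 2).inv |> fun h => by
    simpa [div_eq_mul_inv] using h) hyu hyv (by positivity)
    (fun x => (x - x₀) ^ 2 + B ^ 2) (fun t => 2 * (t - x₀)) hφ hder hsmono.injOn hT fun t ht => ?_
  have h1 : (t - x₀) ^ 2 + B ^ 2 ≠ 0 := by positivity
  rw [abs_of_nonneg (by linarith [ht.1])]
  field_simp

/-- `∫ γ (x − x₀)/((x − x₀)² + B²)` over `[u, v]` with `v ≤ x₀` is a cell sum: the decreasing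
substitution `y = (x − x₀)² + B²` gives `L(−γ/2; ·, ·)`. -/
theorem isCellSum_lineRep_lin_quad_left (hu : IsAlgebraic ℚ u) (hv : IsAlgebraic ℚ v) (huv : u ≤ v)
    {γ x₀ B : ℝ} (hγ : IsAlgebraic ℚ γ)
    (hx₀ : IsAlgebraic ℚ x₀) (hB : IsAlgebraic ℚ B) (hB0 : 0 < B) (hvx₀ : v ≤ x₀)
    {hS : IsSemialgebraic ℚ (line (Icc u v))}
    {hf : IsSemialgebraicFunOn ℚ (line (Icc u v))
      (fun x => γ * (x 0 - x₀) / ((x 0 - x₀) ^ 2 + B ^ 2))}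
    {hi : IntegrableOn (fun x => γ * (x - x₀) / ((x - x₀) ^ 2 + B ^ 2)) (Icc u v)} :
    IsCellSum (of (lineRep (Icc u v) (fun x => γ * (x - x₀) / ((x - x₀) ^ 2 + B ^ 2))
      hS hf hi)) := by
  have hφ : IsSemialgebraicFunOn ℚ (line (Icc u v)) (fun x => (x 0 - x₀) ^ 2 + B ^ 2) :=
    (((isSemialgebraicFunOn_apply hS 0).fun_sub
      (isSemialgebraicFunOn_const_of_isAlgebraic hS hx₀)).fun_pow 2).fun_add
      (isSemialgebraicFunOn_const_of_isAlgebraic hS (by simpa [sq] using hB.mul hB))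
  have hder : ∀ t ∈ Icc u v,
      HasDerivWithinAt (fun x => (x - x₀) ^ 2 + B ^ 2) (2 * (t - x₀)) (Icc u v) t := by
    intro t _
    have h := (((hasDerivAt_id t).sub_const x₀).pow 2).add_const (B ^ 2)
    refine (h.congr_deriv ?_).hasDerivWithinAt
    simp
  have hsanti : StrictAntiOn (fun x => (x - x₀) ^ 2 + B ^ 2) (Icc u v) :=
    fun a _ b hb hab => by
      have : b - x₀ ≤ 0 := by linarith [hb.2]
      nlinarith
  have hcont : ContinuousOn (fun x => (x - x₀) ^ 2 + B ^ 2) (Icc u v) :=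
    (((continuous_id.sub continuous_const).pow 2).add continuous_const).continuousOn
  have hT := image_Icc_of_antitoneOn huv hcont hsanti.antitoneOn
  have hyu : IsAlgebraic ℚ ((u - x₀) ^ 2 + B ^ 2) :=
    (by simpa [sq] using (hu.sub hx₀).mul (hu.sub hx₀) : IsAlgebraic ℚ ((u - x₀) ^ 2)).add
      (by simpa [sq] using hB.mul hB)
  have hyv : IsAlgebraic ℚ ((v - x₀) ^ 2 + B ^ 2) :=
    (by simpa [sq] using (hv.sub hx₀).mul (hv.sub hx₀) : IsAlgebraic ℚ ((v - x₀) ^ 2)).add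
      (by simpa [sq] using hB.mul hB)
  refine isCellSum_lineRep_subst_log (e := -γ / 2) (hγ.neg.mul (isAlgebraic_nat 2).inv |>
    fun h => by simpa [div_eq_mul_inv] using h) hyv hyu (by positivity)
    (fun x => (x - x₀) ^ 2 + B ^ 2) (fun t => 2 * (t - x₀)) hφ hder hsanti.injOn hT fun t ht => ?_
  have h1 : (t - x₀) ^ 2 + B ^ 2 ≠ 0 := by positivity
  rw [abs_of_nonpos (by linarith [ht.2])]
  field_simp

/-- **`∫ γ (x − x₀)/((x − x₀)² + B²)` is a cell sum** (`B > 0`): split `[u, v]` at `x₀` if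
necessary and substitute `y = (x − x₀)² + B²` on each side. -/
theorem isCellSum_lineRep_lin_quad (hu : IsAlgebraic ℚ u) (hv : IsAlgebraic ℚ v) (huv : u ≤ v)
    {γ x₀ B : ℝ} (hγ : IsAlgebraic ℚ γ)
    (hx₀ : IsAlgebraic ℚ x₀) (hB : IsAlgebraic ℚ B) (hB0 : 0 < B)
    {hS : IsSemialgebraic ℚ (line (Icc u v))}
    {hf : IsSemialgebraicFunOn ℚ (line (Icc u v))
      (fun x => γ * (x 0 - x₀) / ((x 0 - x₀) ^ 2 + B ^ 2))}
    {hi : IntegrableOn (fun x => γ * (x - x₀) / ((x - x₀) ^ 2 + B ^ 2)) (Icc u v)} :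
    IsCellSum (of (lineRep (Icc u v) (fun x => γ * (x - x₀) / ((x - x₀) ^ 2 + B ^ 2))
      hS hf hi)) := by
  by_cases hx₀u : x₀ ≤ u
  · exact isCellSum_lineRep_lin_quad_right hu hv huv hγ hx₀ hB hB0 hx₀u
  by_cases hvx₀ : v ≤ x₀
  · exact isCellSum_lineRep_lin_quad_left hu hv huv hγ hx₀ hB hB0 hvx₀
  have hux : u ≤ x₀ := (not_le.mp hx₀u).le
  have hxv : x₀ ≤ v := (not_le.mp hvx₀).le
  -- split at `x₀`
  have hS₁ : IsSemialgebraic ℚ (line (Icc u x₀)) := isSemialgebraic_line_Icc hu hx₀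
  have hS₂ : IsSemialgebraic ℚ (line (Icc x₀ v)) := isSemialgebraic_line_Icc hx₀ hv
  have hsub₁ : line (Icc u x₀) ⊆ line (Icc u v) := line_mono (Icc_subset_Icc_right hxv)
  have hsub₂ : line (Icc x₀ v) ⊆ line (Icc u v) := line_mono (Icc_subset_Icc_left hux)
  have hleft := isCellSum_lineRep_lin_quad_left hu hx₀ hux hγ hx₀ hB hB0 le_rfl (hS := hS₁)
    (hf := hf.mono hsub₁ hS₁) (hi := hi.mono_set (Icc_subset_Icc_right hxv))
  have hright := isCellSum_lineRep_lin_quad_right hx₀ hv hxv hγ hx₀ hB hB0 le_rfl (hS := hS₂)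
    (hf := hf.mono hsub₂ hS₂) (hi := hi.mono_set (Icc_subset_Icc_left hux))
  refine (hleft.add hright).of_sub_mem ?_
  have h := lineRep_split hux hxv (fun x => γ * (x - x₀) / ((x - x₀) ^ 2 + B ^ 2)) (hS := hS)
    (hf := hf) (hi := hi) (hS₁ := hS₁) (hf₁ := hf.mono hsub₁ hS₁)
    (hi₁ := hi.mono_set (Icc_subset_Icc_right hxv)) (hS₂ := hS₂) (hf₂ := hf.mono hsub₂ hS₂)
    (hi₂ := hi.mono_set (Icc_subset_Icc_left hux))
  convert h using 1
  abel

end terms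

end SoloBlind

end Summit.KontsevichZagierPeriods.KontsevichZagierPeriods.Theorems
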